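import Mathlib

/-!
# Polymath 8a, §3: the finer-than-dyadic smooth partition of unity (proof of Lemma 2.7)

Support file for the named fact `Literature.NumberTheory.Sieve.mpz_of_lt` (**parity.S29**,
`ParityWave0.lean`): D. H. J. Polymath, *New equidistribution estimates of Zhang type*, Algebra &
Number Theory 8:9 (2014) 2067–2199 = arXiv:1402.0811.  After the Heath-Brown identity, the proof of
Lemma 2.7 (§3) performs "a finer-than-dyadic decomposition (a standard idea going back at least to
Fouvry and Fouvry–Iwaniec)": with `Θ := 1 + log^{-A₀} x` and a smooth `ψ` equal to `1` on `[-1, 1]`,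
supported on `[-Θ, Θ]`, with `|ψ^{(m)}| ≪_m log^{m A₀} x`, the pieces `ψ_N(n) := ψ(n/N) − ψ(Θ n/N)`,
`N ∈ D = {Θ^m}`, form a partition of unity `1 = ∑_{N ∈ D} ψ_N(n)` with `ψ_N` supported in
`[Θ^{-1} N, Θ N]`.  This file PROVES the existence of such a cutoff with the stated derivative control
and the properties of the pieces:

* `exists_smooth_cutoff_deriv_le` — absolute constants `C_m` and, for every `Θ > 1`, a `ψ ∈ C^∞(ℝ)` with
  values in `[0, 1]`, antitone, `ψ = 1` on `(-∞, 1]`, `ψ = 0` on `[Θ, ∞)`, and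
  `|ψ^{(m)}| ≤ C_m (Θ − 1)^{-m}` (so `≪_m log^{m A₀} x` for `Θ = 1 + log^{-A₀} x`); the construction is
  `ψ(t) = S((Θ − t)/(Θ − 1))` with `S` Mathlib's `Real.smoothTransition`, whose iterated derivatives
  are bounded (`exists_bound_iteratedDeriv_smoothTransition`).  (Only `t ≥ 0` is ever used, so the
  cutoff is recorded one-sidedly rather than as an even function.)
* `sum_range_cutoff_eq_one` — the partition of unity: for `t ≥ 1` and `Θ t ≤ Θ^M`,
  `∑_{m < M} (ψ(t/Θ^m) − ψ(Θ t/Θ^m)) = 1` (a telescoping sum);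
* `cutoff_piece_eq_zero` — `ψ_N(t) = 0` unless `N/Θ < t < Θ N`; `cutoff_piece_mem_Icc` —
  `0 ≤ ψ_N ≤ 1`.

Nothing here discharges `mpz_of_lt`; the Type 0 case fed by these pieces is
`Polymath8aTypeZero.lean`, the combinatorial sorting is `Polymath8aCombinatorialLemma.lean`.

## References

* D. H. J. Polymath, *New equidistribution estimates of Zhang type*, Algebra & Number Theory 8:9
  (2014), 2067–2199, arXiv:1402.0811: §3, proof of Lemma 2.7 (the finer-than-dyadic decomposition).
  [cite: Polymath8a2014]
-/

open Finset
open scoped ContDiff Topology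

namespace Literature.NumberTheory.Sieve

namespace Polymath8a

/-- The iterated derivatives of Mathlib's `Real.smoothTransition` are bounded (each is continuous and
vanishes off `[0, 1]`, where the function is locally constant). [folklore] -/
theorem exists_bound_iteratedDeriv_smoothTransition (m : ℕ) :
    ∃ C : ℝ, 0 ≤ C ∧ ∀ u : ℝ, |iteratedDeriv m Real.smoothTransition u| ≤ C := by
  -- bound on the compact interval `[-1, 2]`
  have hcont : Continuous (iteratedDeriv m Real.smoothTransition) :=
    Real.smoothTransition.contDiff.continuous_iteratedDeriv m (by exact_mod_cast le_top)
  obtain ⟨C₀, hC₀⟩ := (isCompact_Icc (a := (-1 : ℝ)) (b := 2)).exists_bound_of_continuousOn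
    hcont.continuousOn
  refine ⟨max C₀ 1, le_max_of_le_right zero_le_one, fun u => ?_⟩
  by_cases hu : u ∈ Set.Icc (-1 : ℝ) 2
  · exact ((Real.norm_eq_abs _).symm.le.trans (hC₀ u hu)).trans (le_max_left _ _)
  · -- off `[-1, 2]` the function is locally constant (`0` or `1`)
    rw [Set.mem_Icc, not_and_or, not_le, not_le] at hu
    have hconst : ∃ c : ℝ, |c| ≤ 1 ∧ Real.smoothTransition =ᶠ[𝓝 u] fun _ => c := by
      rcases hu with hu | hu
      · refine ⟨0, by simp, ?_⟩
        filter_upwards [eventually_lt_nhds (show u < 0 by linarith)] with v hv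
        exact Real.smoothTransition.zero_of_nonpos hv.le
      · refine ⟨1, by simp, ?_⟩
        filter_upwards [eventually_gt_nhds (show (1 : ℝ) < u by linarith)] with v hv
        exact Real.smoothTransition.one_of_one_le hv.le
    obtain ⟨c, hc, hEq⟩ := hconst
    rw [(hEq.iteratedDeriv m).eq_of_nhds, iteratedDeriv_const]
    split_ifs
    · exact hc.trans (le_max_right _ _)
    · rw [abs_zero]; exact le_max_of_le_right zero_le_one

/-- **A smooth cutoff with controlled derivatives** (the function `ψ` of the finer-than-dyadic
decomposition in the proof of Polymath 8a Lemma 2.7, §3: "Let `ψ : ℝ → ℝ` be a smooth function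
supported on `[-Θ, Θ]` that is equal to `1` on `[-1, 1]` and obeys the derivative estimates
`|ψ^{(m)}(x)| ≪ log^{m A₀} x` … where the implied constant depends only on `m`", with
`Θ = 1 + log^{-A₀} x`).  For `t ≥ 0` only the right half matters, and we record it one-sidedly:
there are absolute constants `C_m` such that for every `Θ > 1` there is `ψ ∈ C^∞(ℝ)`, valued in
`[0, 1]`, antitone, equal to `1` on `(-∞, 1]` and to `0` on `[Θ, ∞)`, with
`|ψ^{(m)}(t)| ≤ C_m (Θ − 1)^{-m}` for all `m` and `t` (take `ψ(t) = S((Θ − t)/(Θ − 1))` with `S`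
Mathlib's `Real.smoothTransition`). [cite: Polymath8a2014, §3, proof of Lemma 2.7 (the function ψ)] -/
theorem exists_smooth_cutoff_deriv_le :
    ∃ C : ℕ → ℝ, (∀ m, 0 ≤ C m) ∧ ∀ Θ : ℝ, 1 < Θ → ∃ ψ : ℝ → ℝ, ContDiff ℝ ∞ ψ ∧
      (∀ t, t ≤ 1 → ψ t = 1) ∧ (∀ t, Θ ≤ t → ψ t = 0) ∧ (∀ t, 0 ≤ ψ t ∧ ψ t ≤ 1) ∧
      Antitone ψ ∧ ∀ (m : ℕ) (t : ℝ), |iteratedDeriv m ψ t| ≤ C m / (Θ - 1) ^ m := by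
  choose C hC0 hC using exists_bound_iteratedDeriv_smoothTransition
  refine ⟨C, hC0, fun Θ hΘ => ?_⟩
  set L : ℝ := Θ - 1 with hL
  have hL0 : 0 < L := by rw [hL]; linarith
  -- `ψ(t) = S(Θ/L + (-1/L) t) = S((Θ - t)/L)`
  set g : ℝ → ℝ := fun u => Real.smoothTransition (Θ / L + u) with hg
  set ψ : ℝ → ℝ := fun t => g ((-1 / L) * t) with hψ
  have harg : ∀ t, Θ / L + (-1 / L) * t = (Θ - t) / L := fun t => by field_simp; ring
  have hψ_apply : ∀ t, ψ t = Real.smoothTransition ((Θ - t) / L) := fun t => by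
    simp only [hψ, hg, harg]
  have hgdiff : ContDiff ℝ ∞ g :=
    Real.smoothTransition.contDiff.comp (contDiff_const.add contDiff_id)
  have hψdiff : ContDiff ℝ ∞ ψ := hgdiff.comp (contDiff_const.mul contDiff_id)
  refine ⟨ψ, hψdiff, fun t ht => ?_, fun t ht => ?_, fun t => ?_, ?_, fun m t => ?_⟩
  · rw [hψ_apply]
    exact Real.smoothTransition.one_of_one_le ((one_le_div hL0).mpr (by rw [hL]; linarith))
  · rw [hψ_apply]
    exact Real.smoothTransition.zero_of_nonpos (div_nonpos_of_nonpos_of_nonneg (by linarith) hL0.le)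
  · rw [hψ_apply]
    exact ⟨Real.smoothTransition.nonneg _, Real.smoothTransition.le_one _⟩
  · intro s t hst
    rw [hψ_apply, hψ_apply]
    exact Real.smoothTransition.monotone (div_le_div_of_nonneg_right (by linarith) hL0.le)
  · -- derivatives: chain rule for the affine reparametrisation
    have h1 : iteratedDeriv m ψ = fun t => (-1 / L) ^ m * iteratedDeriv m g ((-1 / L) * t) := by
      rw [hψ]
      exact iteratedDeriv_comp_const_mul (hgdiff.of_le (by exact_mod_cast le_top)) (-1 / L)
    have h2 : iteratedDeriv m g = fun u => iteratedDeriv m Real.smoothTransition (Θ / L + u) := by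
      rw [hg]
      exact iteratedDeriv_comp_const_add m Real.smoothTransition (Θ / L)
    rw [h1]
    simp only [h2]
    calc |(-1 / L) ^ m * iteratedDeriv m Real.smoothTransition (Θ / L + (-1 / L) * t)|
        = (L ^ m)⁻¹ * |iteratedDeriv m Real.smoothTransition (Θ / L + (-1 / L) * t)| := by
          rw [abs_mul, abs_pow, abs_div, abs_neg, abs_one, abs_of_pos hL0, one_div, inv_pow]
      _ ≤ (L ^ m)⁻¹ * C m := mul_le_mul_of_nonneg_left (hC m _) (by positivity)
      _ = C m / L ^ m := by rw [div_eq_mul_inv, mul_comm]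

/-- **The finer-than-dyadic partition of unity** (Polymath 8a §3, proof of Lemma 2.7: "We then have
a smooth partition of unity `1 = ∑_{N ∈ D} ψ_N(n)` indexed by the multiplicative semigroup
`D := {Θ^m : m ∈ ℕ ∪ {0}}` for any natural number `n`, where `ψ_N(n) := ψ(n/N) − ψ(Θ n/N)`").
The sum telescopes: for `ψ = 1` on `(-∞, 1]` and `ψ = 0` on `[Θ, ∞)`, every `t ≥ 1` and every `M`
with `Θ t ≤ Θ^M`, `∑_{m < M} (ψ(t/Θ^m) − ψ(Θ t/Θ^m)) = 1` (the terms with `Θ^m ∉ (t/Θ, Θ t)`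
vanish, so this is the full sum over `D`). [cite: Polymath8a2014, §3, proof of Lemma 2.7 (partition of unity)] -/
theorem sum_range_cutoff_eq_one {ψ : ℝ → ℝ} {Θ : ℝ} (hΘ : 1 < Θ) (hψ1 : ∀ t, t ≤ 1 → ψ t = 1)
    (hψ0 : ∀ t, Θ ≤ t → ψ t = 0) {t : ℝ} (ht : 1 ≤ t) {M : ℕ} (hM : Θ * t ≤ Θ ^ M) :
    ∑ m ∈ Finset.range M, (ψ (t / Θ ^ m) - ψ (Θ * t / Θ ^ m)) = 1 := by
  have hΘ0 : 0 < Θ := by linarith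
  -- telescoping with `f m = ψ(Θ t / Θ^m)`, `f (m+1) = ψ(t / Θ^m)`
  have hstep : ∀ m : ℕ, ψ (t / Θ ^ m) = ψ (Θ * t / Θ ^ (m + 1)) := fun m => by
    congr 1
    rw [pow_succ]
    field_simp
  have htel : ∑ m ∈ Finset.range M, (ψ (t / Θ ^ m) - ψ (Θ * t / Θ ^ m)) =
      ψ (Θ * t / Θ ^ M) - ψ (Θ * t / Θ ^ 0) := by
    simp_rw [hstep]
    exact Finset.sum_range_sub (fun m => ψ (Θ * t / Θ ^ m)) M
  rw [htel, pow_zero, div_one, hψ0 (Θ * t) (le_mul_of_one_le_right hΘ0.le ht), sub_zero]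
  exact hψ1 _ ((div_le_one (pow_pos hΘ0 M)).mpr hM)

/-- Support of the pieces of the partition of unity: `ψ_N(t) = ψ(t/N) − ψ(Θ t/N)` vanishes unless
`N/Θ < t < Θ N` ("`ψ_N` is supported in `[Θ^{-1} N, Θ N]`"), for `ψ` as in `exists_smooth_cutoff_deriv_le`
and `t ≥ 0`. [cite: Polymath8a2014, §3, proof of Lemma 2.7 (partition of unity)] -/
theorem cutoff_piece_eq_zero {ψ : ℝ → ℝ} {Θ : ℝ} (hΘ : 1 < Θ) (hψ1 : ∀ t, t ≤ 1 → ψ t = 1)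
    (hψ0 : ∀ t, Θ ≤ t → ψ t = 0) {N : ℝ} (hN : 0 < N) {t : ℝ} (ht0 : 0 ≤ t)
    (ht : t ≤ N / Θ ∨ Θ * N ≤ t) : ψ (t / N) - ψ (Θ * t / N) = 0 := by
  have hΘ0 : 0 < Θ := by linarith
  rcases ht with h | h
  · -- both arguments are `≤ 1`
    have h1 : Θ * t / N ≤ 1 := by
      rw [div_le_one hN]
      calc Θ * t ≤ Θ * (N / Θ) := by gcongr
        _ = N := by field_simp
    have h2 : t / N ≤ 1 := by
      refine le_trans ?_ h1
      gcongr
      nlinarith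
    rw [hψ1 _ h2, hψ1 _ h1, sub_self]
  · -- both arguments are `≥ Θ`
    have h1 : Θ ≤ t / N := by rwa [le_div_iff₀ hN]
    have h2 : Θ ≤ Θ * t / N := by
      refine le_trans h1 ?_
      rw [mul_div_assoc]
      exact le_mul_of_one_le_left (by positivity) hΘ.le
    rw [hψ0 _ h1, hψ0 _ h2, sub_self]

/-- The pieces take values in `[0, 1]` when `ψ` is antitone with values in `[0, 1]` (as in
`exists_smooth_cutoff_deriv_le`), for `t ≥ 0` and `N > 0`. [cite: Polymath8a2014, §3, proof of Lemma 2.7 (partition of unity)] -/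
theorem cutoff_piece_mem_Icc {ψ : ℝ → ℝ} {Θ : ℝ} (hΘ : 1 ≤ Θ) (hψ : Antitone ψ)
    (hψ01 : ∀ t, 0 ≤ ψ t ∧ ψ t ≤ 1) {N : ℝ} (hN : 0 < N) {t : ℝ} (ht0 : 0 ≤ t) :
    ψ (t / N) - ψ (Θ * t / N) ∈ Set.Icc (0 : ℝ) 1 := by
  have hle : t / N ≤ Θ * t / N := by
    rw [mul_div_assoc]
    exact le_mul_of_one_le_left (by positivity) hΘ
  refine ⟨sub_nonneg.mpr (hψ hle), ?_⟩
  linarith [(hψ01 (t / N)).2, (hψ01 (Θ * t / N)).1]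

end Polymath8a

end Literature.NumberTheory.Sieve
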